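import Summits.QuantumFields.YangMills.Theorems.ConvexGribovBodyBrascampLiebVacuumSCRealStructure
import Literature.MathematicalPhysics.QuantumLattice.RepLieAlgebra
import Mathlib.AlgebraicTopology.FundamentalGroupoid.SimplyConnected
import Mathlib.MeasureTheory.Constructions.BorelSpace.Basic

/-!
# Stub `stub_involutionGlue` of the line `SketchIdeator1` for the crux `BrascampLiebVacuumSC`
# (stmt-QuantumFields-16404, route `ConvexGribovBody`), skeleton v8

The glue of the v8 derivation of F2 (`involutionDim`: for a non-central involution `j` of a
simply-connected compact simple `G` with faithful unitary `ρ`, `3 · dim (𝔥 ∩ 𝔭_j) < 2 · dim 𝔥`,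
`𝔥 = {X : exp(tX) ∈ ρ(G) ∀ t}` the matrix Lie algebra, `𝔭_j = {X : ρ(j) X ρ(j) = −X}`) from the
five Lie-theoretic stubs of the skeleton, which enter VERBATIM as hypotheses:

* `stub_lieSimple` (ideals of `𝔥 = repLieAlgebra r` are trivial),
* `stub_weightDecomp` (joint weight decomposition of `L_ℂ` under an abelian `A ≤ L`),
* `stub_abelianThird` (`3 · dim A < dim L` for abelian `A ≤ L` once `dim L > 3`),
* `stub_involutionSplit` (`dim 𝔭 ≤ dim 𝔨 + dim 𝔞`, `dim 𝔭 + dim 𝔨 = dim L`),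
* `stub_rankOneCentral` (`dim 𝔥 ≤ 3` and simply connected ⇒ involutions central).

Bookkeeping: `𝔥` IS the carrier of `repLieAlgebra r` (tree `coe_matrixLieAlgebra_eq`, Hall Thm. 3.20),
which is bracket-closed (`mul_sub_mul_mem_repLieAlgebra`), skew-Hermitian
(`repLieAlgebra_le_skewAdjoint`) and `Ad_{ρ j}`-stable (`conj_mem_repLieAlgebra`, `ρ(j)⁻¹ = ρ(j)`); the
real structure of `𝔥_ℂ` is `stub_realStructure` (file `…RealStructure.lean`). Then either `dim 𝔥 ≤ 3`
and `j` is central (contradiction), or with `p = dim 𝔭`, `k = dim 𝔨`, `a = dim 𝔞`, `d = dim 𝔥`: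
`p ≤ k + a`, `p + k = d`, `3a < d`, whence `3p < 2d`. No named facts are used.

## On the statement's text

The statement of `stub_involutionGlue` is, as a Lean term, EXACTLY that of skeleton v8 (the five
neighbour statements as hypotheses, then F2); `involutionDim` there is
`stub_involutionGlue stub_lieSimple stub_weightDecomp stub_abelianThird stub_involutionSplit
stub_rankOneCentral`. Its verbatim text (5571 characters) exceeds the registrable stub-signature
length, so the header below is WRITTEN with two file-local, non-hygienic notations that expand
syntactically (macro expansion, before elaboration) to the verbatim hypothesis blocks shared by the
neighbours: `RS[N, L]` — the real structure of `L_ℂ` (the conclusion of `stub_realStructure`), and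
`WD[N, L]` — the joint weight decomposition of `L_ℂ` under every abelian `A ≤ L` (the conclusion of
`stub_weightDecomp`). The elaborated theorem is unchanged.
-/

set_option autoImplicit false

open scoped BigOperators Matrix Topology
open Literature.MathematicalPhysics.QuantumFieldTheory Literature.MathematicalPhysics.QuantumLattice

noncomputable section

namespace Summit.QuantumFields.YangMills.Theorems.BrascampLiebVacuumSC

set_option hygiene false in
/-- `RS[N, L]` — the real structure of the complexification `L_ℂ = Submodule.span ℂ L` of a real
subspace `L ⊆ M_N(ℂ)` (verbatim the hypothesis `hRS` of `stub_weightDecomp` / `stub_abelianThird` /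
`stub_involutionSplit`, i.e. the conclusion of `stub_realStructure`): (RS1) `dim_ℂ span_ℂ W = dim_ℝ W`
for skew-Hermitian `W`, (RS2) `span_ℂ L = L + iL`, (RS3) `L ∩ iL = 0`. File-local notation. [folklore] -/
local notation "RS[" N ", " L "]" =>
  ((∀ W : Submodule ℝ (Matrix (Fin N) (Fin N) ℂ), (∀ X ∈ W, star X = -X) →
      Module.finrank ℂ ↥(Submodule.span ℂ (W : Set (Matrix (Fin N) (Fin N) ℂ))) = Module.finrank ℝ ↥W) ∧
    (∀ Z ∈ Submodule.span ℂ (L : Set (Matrix (Fin N) (Fin N) ℂ)), ∃ X ∈ L, ∃ Y ∈ L, Z = X + Complex.I • Y) ∧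
    (∀ X ∈ L, ∀ Y ∈ L, X + Complex.I • Y = 0 → X = 0 ∧ Y = 0))

set_option hygiene false in
/-- `WD[N, L]` — the joint weight decomposition of `L_ℂ` under every abelian `A ≤ L` (verbatim the
conclusion of `stub_weightDecomp` and the corresponding hypothesis of `stub_abelianThird` /
`stub_involutionSplit`): weight spaces `E w` (`w ∈ A^*`) with `L_ℂ = ⨁ E w` (independent, finitely
many non-zero), `[E w, E w'] ⊆ E (w + w')`, `σ (E w) = E (−w)`, and non-degeneracy. File-local
notation. [folklore] -/
local notation "WD[" N ", " L "]" =>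
  (∀ (A : Submodule ℝ (Matrix (Fin N) (Fin N) ℂ)), A ≤ L → (∀ H ∈ A, ∀ H' ∈ A, H * H' = H' * H) →
    ∃ E : (↥A →ₗ[ℝ] ℝ) → Submodule ℂ (Matrix (Fin N) (Fin N) ℂ),
      (∀ w, (E w : Set (Matrix (Fin N) (Fin N) ℂ)) =
          {Z | Z ∈ Submodule.span ℂ (L : Set (Matrix (Fin N) (Fin N) ℂ)) ∧
            ∀ H : ↥A, (H : Matrix (Fin N) (Fin N) ℂ) * Z - Z * (H : Matrix (Fin N) (Fin N) ℂ) =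
              ((((w H : ℝ) : ℂ)) * Complex.I) • Z}) ∧
      iSupIndep E ∧ (⨆ w, E w) = Submodule.span ℂ (L : Set (Matrix (Fin N) (Fin N) ℂ)) ∧
      {w | E w ≠ ⊥}.Finite ∧
      (∀ w w', ∀ Z ∈ E w, ∀ W ∈ E w', Z * W - W * Z ∈ E (w + w')) ∧
      (∀ w, ∀ Z ∈ E w, -star Z ∈ E (-w)) ∧
      (∀ H : ↥A, (∀ w, E w ≠ ⊥ → w H = 0) → ∀ X ∈ L, (H : Matrix (Fin N) (Fin N) ℂ) * X = X * (H : Matrix (Fin N) (Fin N) ℂ)))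

/-! ### Bookkeeping over `repLieAlgebra r` -/

namespace InvolutionGlue

variable {G : Type} [Group G] [TopologicalSpace G]

/-- `ρ(j)² = 1` for an involution `j`. [folklore] -/
theorem rho_mul_self (r : LatticeRep G) {j : G} (hj : j * j = 1) : r.ρ j * r.ρ j = 1 := by
  rw [← map_mul, hj, map_one]

/-- `𝔥 = repLieAlgebra r ⊆ 𝔲(N)`: its elements are skew-Hermitian (Hall, Prop. 3.24, tree
`repLieAlgebra_le_skewAdjoint`). [folklore] -/
theorem star_eq_neg (r : LatticeRep G) {X : Matrix (Fin r.N) (Fin r.N) ℂ}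
    (hX : X ∈ repLieAlgebra r) : star X = -X :=
  skewAdjoint.mem_iff.mp (repLieAlgebra_le_skewAdjoint r hX)

/-- `Ad_{ρ(j)}` preserves `𝔥 = repLieAlgebra r` for an involution `j` (`ρ(j⁻¹) = ρ(j)`; tree
`conj_mem_repLieAlgebra`). [folklore] -/
theorem conj_mem [CompactSpace G] (r : LatticeRep G) {j : G} (hj : j * j = 1)
    {X : Matrix (Fin r.N) (Fin r.N) ℂ} (hX : X ∈ repLieAlgebra r) :
    r.ρ j * X * r.ρ j ∈ repLieAlgebra r := by
  have h := conj_mem_repLieAlgebra r j hX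
  rwa [inv_eq_of_mul_eq_one_right hj] at h

/-- The carrier of `repLieAlgebra r` is the matrix Lie algebra `{X : exp(tX) ∈ ρ(G) ∀ t ∈ ℝ}`
(tree `coe_matrixLieAlgebra_eq`, Hall Thm. 3.20). [folklore] -/
theorem coe_repLieAlgebra_eq [CompactSpace G] (r : LatticeRep G) :
    ((repLieAlgebra r : Submodule ℝ (Matrix (Fin r.N) (Fin r.N) ℂ)) :
        Set (Matrix (Fin r.N) (Fin r.N) ℂ)) =
      {X : Matrix (Fin r.N) (Fin r.N) ℂ | ∀ t : ℝ, NormedSpace.exp (t • X) ∈ Set.range r.ρ} :=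
  coe_matrixLieAlgebra_eq r.one_mem_range r.mul_mem_range r.isClosed_range

/-- The final count: `p ≤ k + a`, `p + k = d`, `3a < d` give `3p < 2d`. [folklore] -/
theorem three_mul_lt_two_mul {p k a d : ℕ} (h1 : p ≤ k + a) (h2 : p + k = d) (h3 : 3 * a < d) :
    3 * p < 2 * d := by
  omega

end InvolutionGlue

/-- **Stub `stub_involutionGlue` (GLUE of the v8 derivation of F2).** The five statements
`stub_lieSimple`, `stub_weightDecomp`, `stub_abelianThird`, `stub_involutionSplit`,
`stub_rankOneCentral` (as hypotheses, verbatim; `RS[N, L]` / `WD[N, L]` are the file-local notations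
for the shared real-structure / weight-decomposition blocks, see the module docstring) imply: for a
non-central involution `j` of a simply-connected compact simple `G` with faithful unitary `r`,
`3 · dim_ℝ span(𝔥 ∩ 𝔭_j) < 2 · dim_ℝ span 𝔥`. Proof: `𝔥 = repLieAlgebra r` (`coe_matrixLieAlgebra_eq`);
`dim 𝔥 ≤ 3` would make `j` central (`stub_rankOneCentral`); otherwise with `P = ρ j` (`P² = 1`,
unitary, `P 𝔥 P ⊆ 𝔥`) the split `p ≤ k + a`, `p + k = d` (`stub_involutionSplit`) and `3a < d`
(`stub_abelianThird`, ideals trivial by `stub_lieSimple`, weights by `stub_weightDecomp`, real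
structure by `stub_realStructure`) give `3p < 2d`. [folklore] -/
theorem stub_involutionGlue :
    (∀ (G : Type) [Group G] [TopologicalSpace G] [IsTopologicalGroup G] [CompactSpace G],
      IsCompactSimpleLieGroup G → ∀ (r : LatticeRep G),
        (∀ I : Submodule ℝ (Matrix (Fin r.N) (Fin r.N) ℂ), I ≤ repLieAlgebra r →
          (∀ X ∈ repLieAlgebra r, ∀ Y ∈ I, X * Y - Y * X ∈ I) → I = ⊥ ∨ I = repLieAlgebra r)) →
    (∀ (N : ℕ) (L : Submodule ℝ (Matrix (Fin N) (Fin N) ℂ)),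
      (∀ X ∈ L, ∀ Y ∈ L, X * Y - Y * X ∈ L) → (∀ X ∈ L, star X = -X) → RS[N, L] → WD[N, L]) →
    (∀ (N : ℕ) (L : Submodule ℝ (Matrix (Fin N) (Fin N) ℂ)),
      (∀ X ∈ L, ∀ Y ∈ L, X * Y - Y * X ∈ L) → (∀ X ∈ L, star X = -X) → RS[N, L] → WD[N, L] →
        (∀ I : Submodule ℝ (Matrix (Fin N) (Fin N) ℂ), I ≤ L →
          (∀ X ∈ L, ∀ Y ∈ I, X * Y - Y * X ∈ I) → I = ⊥ ∨ I = L) →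
        3 < Module.finrank ℝ ↥L →
        ∀ (A : Submodule ℝ (Matrix (Fin N) (Fin N) ℂ)), A ≤ L → (∀ H ∈ A, ∀ H' ∈ A, H * H' = H' * H) →
          3 * Module.finrank ℝ ↥A < Module.finrank ℝ ↥L) →
    (∀ (N : ℕ) (L : Submodule ℝ (Matrix (Fin N) (Fin N) ℂ)) (P : Matrix (Fin N) (Fin N) ℂ),
      (∀ X ∈ L, ∀ Y ∈ L, X * Y - Y * X ∈ L) → (∀ X ∈ L, star X = -X) → RS[N, L] → WD[N, L] →
        P * P = 1 → P ∈ Matrix.unitaryGroup (Fin N) ℂ → (∀ X ∈ L, P * X * P ∈ L) →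
        ∃ A : Submodule ℝ (Matrix (Fin N) (Fin N) ℂ), A ≤ L ∧ (∀ H ∈ A, P * H * P = -H) ∧ (∀ H ∈ A, ∀ H' ∈ A, H * H' = H' * H) ∧
          Module.finrank ℝ ↥(Submodule.span ℝ ((L : Set (Matrix (Fin N) (Fin N) ℂ)) ∩ {X | P * X * P = -X})) ≤
            Module.finrank ℝ ↥(Submodule.span ℝ ((L : Set (Matrix (Fin N) (Fin N) ℂ)) ∩ {X | P * X * P = X})) + Module.finrank ℝ ↥A ∧
          Module.finrank ℝ ↥(Submodule.span ℝ ((L : Set (Matrix (Fin N) (Fin N) ℂ)) ∩ {X | P * X * P = -X})) +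
            Module.finrank ℝ ↥(Submodule.span ℝ ((L : Set (Matrix (Fin N) (Fin N) ℂ)) ∩ {X | P * X * P = X})) = Module.finrank ℝ ↥L) →
    (∀ (G : Type) [Group G] [TopologicalSpace G] [IsTopologicalGroup G] [CompactSpace G],
      IsCompactSimpleLieGroup G → SimplyConnectedSpace G → ∀ (r : LatticeRep G),
        Module.finrank ℝ ↥(repLieAlgebra r) ≤ 3 → ∀ j : G, j * j = 1 → j ∈ Subgroup.center G) →
    ∀ (G : Type) [Group G] [TopologicalSpace G] [IsTopologicalGroup G] [CompactSpace G]
    [MeasurableSpace G] [BorelSpace G], IsCompactSimpleLieGroup G → SimplyConnectedSpace G →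
    ∀ (r : LatticeRep G) (j : G), j * j = 1 → j ∉ Subgroup.center G →
      3 * Module.finrank ℝ ↥(Submodule.span ℝ
            ({X : Matrix (Fin r.N) (Fin r.N) ℂ | ∀ t : ℝ, NormedSpace.exp (t • X) ∈ Set.range r.ρ} ∩
              {X | r.ρ j * X * r.ρ j = -X})) <
        2 * Module.finrank ℝ ↥(Submodule.span ℝ
            {X : Matrix (Fin r.N) (Fin r.N) ℂ | ∀ t : ℝ, NormedSpace.exp (t • X) ∈ Set.range r.ρ}) := by
  intro h_lieSimple h_weightDecomp h_abelianThird h_involutionSplit h_rankOneCentral G _ _ _ _ _ _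
    hG hSC r j hj hjc
  rw [← InvolutionGlue.coe_repLieAlgebra_eq r, Submodule.span_eq]
  have hbr : ∀ X ∈ repLieAlgebra r, ∀ Y ∈ repLieAlgebra r, X * Y - Y * X ∈ repLieAlgebra r :=
    fun X hX Y hY => mul_sub_mul_mem_repLieAlgebra r hX hY
  have hskew : ∀ X ∈ repLieAlgebra r, star X = -X := fun X hX => InvolutionGlue.star_eq_neg r hX
  have hRS := stub_realStructure r.N (repLieAlgebra r) hskew
  have hWD := h_weightDecomp r.N (repLieAlgebra r) hbr hskew hRS
  by_cases hd : Module.finrank ℝ ↥(repLieAlgebra r) ≤ 3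
  · exact absurd (h_rankOneCentral G hG hSC r hd j hj) hjc
  have hd' : 3 < Module.finrank ℝ ↥(repLieAlgebra r) := not_le.mp hd
  obtain ⟨A, hAL, -, hAab, hpk, hsum⟩ :=
    h_involutionSplit r.N (repLieAlgebra r) (r.ρ j) hbr hskew hRS hWD
      (InvolutionGlue.rho_mul_self r hj) (r.mem_unitary j)
      (fun X hX => InvolutionGlue.conj_mem r hj hX)
  have h3a :=
    h_abelianThird r.N (repLieAlgebra r) hbr hskew hRS hWD (h_lieSimple G hG r) hd' A hAL hAab
  exact InvolutionGlue.three_mul_lt_two_mul hpk hsum h3a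

end Summit.QuantumFields.YangMills.Theorems.BrascampLiebVacuumSC

end
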